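import Literature.NumberTheory.Automorphic.LocalUnitaryIntegralLevel
import Literature.NumberTheory.Automorphic.HyperspecialUnitaryCartanUnique
import Literature.NumberTheory.Automorphic.ValuedFieldValuativeRelBridge
import HarnessLib

/-!
# R90 · S6 «Ch. 14.1–14.5 stable trace formula» — WAVE 9-A′ «THE FRAME e₀»: one frame `e₀ : U(H′)(L⁺_v) ≃ₜ* U(σ_w, J₀)(L_w)` WITH the
# `unitaryInt` K-law of the S6 sockets (`Theorems/R90S6FrameMemLawUnitaryInt.lean`; DAG r5 row E1.3.3.4 «frame ∕ level-law feed»)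

Cell `hodgecm-mathlib`, crux H413 (`stmt-HodgeConjecture-24833`), route of record `HCCMUnconditional`; programme R90-TF, section S6 (base `R90-C14`),
seat R90-C14-p06 (g0); S6 dealer R90-C14-plan (g2) «W9-A′ RE-CUT PER AUDIT» (R90 bus 2026-09-05T00:00:17Z): «ONE HAND, ONE FILE —
`Theorems/R90S6FrameMemLawUnitaryInt.lean` = the FOUR theorems (F.0) (F.0′) (F.1) (F.2), signatures VERBATIM from sheet d3a1100c24f72f2e (:81 :104 :128 :151),
proofs ported from typ1's scratch; API-module exception GRANTED (4 public theorems about ONE object, the frame e₀)».  Statements VERBATIM from R90-C14-typ1 (g2)'s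
sheet `R90/R90-C14-typ1/g2/S6_wave9Aprime_targets.v1.d3a1100c24f72f2e.lean` (AUDIT BOX S6#W9-A′ SHEET CLEAN ×4 KERNEL-CERTIFIED, R90 bus 2026-09-04T23:59:57Z;
namespace `…R90.S6`, the sheet's `.Wave9Aprime` dropped); proofs = typ1 (g2)'s sorry-free assembly cert `R90/R90-C14-typ1/g2/scratch_W9Aprime_frames.lean`
9e3ef0a23e7dd19f, ported name-for-name.  Helper lane `--supports stmt-HodgeConjecture-24833 --as helper`; THEOREMS ONLY (no definition, no instance, no notation,
no named fact, no `sorry`); imports = ★ `LocalUnitaryIntegralLevel` + ★ `HyperspecialUnitaryCartanUnique` + ★ `ValuedFieldValuativeRelBridge` + HarnessLib (no Lines import).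

WHAT IT FEEDS.  The S6 sockets of D ED. 3b `Cruxes/H413/Lines/R90_S6_FloorE1D.lean` 371da01649ca69fe are ∀-bound over transports with a K-law in `unitaryInt`
currency: `StubR90ExtE1HeckeFL` :298–:306 (`eG` on `(cmDatum L 3 H′).Local v`, `eH` on `(cmDatum L 2 Φ₂).Local v`) and `StubR90ExtE1TwistedTransferFL` conj. 2
:519–:523.  ★ W9-A «eG-independence» (`Theorems/R90S6HeckeCoeffIndep*`) makes the Hecke side independent of the transport, so the assemblies need exactly ONE
frame per carrier with (i) the K-law in the socket's token shape and (ii) a matrix description (`T g_w T⁻¹`, `T ∈ GL_N(𝒪_w)`).  The tree has the ENGINE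
(★ `exists_glInt_placeForm_eq_formCongr_antidiagonal_of_isUnramifiedIn` = Jacobowitz's integral hyperbolic basis; ★ `localNonsplitCongr`, ★ `localNonsplitEquiv`,
★ `localNonsplitEquiv_localNonsplitCongr`, ★ `mem_localIntegralLevel_iff_of_smul_eq`) in the neighbouring currency `U(σ_w, placeForm Φ_N w)`; the two SEAMS to the
socket's currency are ★ one-liners: (S1) FORM `placeForm Φ_N w = (StdForm.antidiagonal N).over E_w` (★ `placeForm_antidiagOne`, transported by ★
`ContinuousMulEquiv.restrictSubgroup (ContinuousMulEquiv.refl _)`); (S2) LEVEL `g ∈ unitaryInt σ J ↔ entries of g, g⁻¹ of valuation ≤ 1 ↔ (g : GL) ∈ glInt`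
(★ `mem_unitaryInt_iff`, ★ `mem_glInt_iff_forall_v_le_one`).  CARRIER: D's `(UnitaryGroup.cmDatum L N H).Local v` IS `↥(UnitaryGroup.«local» L c N H v)` by
★ `cmDatum_Local` (`rfl`) and `cmLocalIntegralLevel` is an `abbrev` of `localIntegralLevel`, so the CM dresses (F.1)∕(F.2) are the general (F.0)∕(F.0′) by `exact`
(KERNEL NOTE J7: never `rw [ContinuousMulEquiv.trans_apply]` under the `(cmDatum …).Local v` spelling — «motive not type-correct under instances transparency»;
all rewriting is done in the `«local»` spelling).

* **`exists_continuousMulEquiv_memLaw_unitaryInt_of_isUnramifiedIn`** — (F.0) general `E ∕ F`, generic `N`, any `c`-hermitian `J` with `J_w ∈ GL_N(𝒪_w)`;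
* **`exists_continuousMulEquiv_memLaw_unitaryInt_antidiagOne_of_smul_eq`** — (F.0′) general, `J := Φ_N`-literal, `T = 1`, no `hv`;
* **`exists_continuousMulEquiv_memLaw_unitaryInt_cm_three`** — (F.1) CM, `N = 3` (binders of ★ `exists_frame_of_nonsplit` verbatim): THE FRAME of the
  E1.3.9 ∕ E1.4.4.5a sockets — its K-law conjunct is D :301–:303 ∕ :521–:523 token for token, so the sockets' `∀ eG, (K-law) → …` is inhabited at every good `v`;
* **`exists_continuousMulEquiv_memLaw_unitaryInt_cm_antidiagOne`** — (F.2) CM, `Φ_N`-literal, generic `N` (the `eH` carrier at `N = 2`, D :304–:306).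

HONEST LABEL: helper theorems (frames), count-neutral until D ED. 4 ∕ the E1.3.9 ∕ E1.4.4.5a assemblies consume them; HC_CM is proved only modulo the 7 printed
citations (2 remaining named inputs: hLiu418 = stmt-HodgeConjecture-24832, h413 = stmt-HodgeConjecture-24833) until rung 0 closes; REL ≠ ★ ≠ BUILT.

## References
* [Rogawski1990] J. D. Rogawski, *Automorphic Representations of Unitary Groups in Three Variables*, Ann. of Math. Stud. 123 (1990), §14.2 p. 233 («K_v ≃ K′_v»),
  §4.9 p. 54.
* [Jacobowitz1962] R. Jacobowitz, *Hermitian forms over local fields*, Amer. J. Math. 84 (1962), §7 Thm. 7.1 (integral hyperbolic basis at an unramified place).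
* [PlatonovRapinchuk1994] V. Platonov, A. Rapinchuk, *Algebraic Groups and Number Theory* (1994), §5.1 (one-place model `U(J)(F_v) ≃ U(σ_w, J_w)(E_w)`), §2.3.
-/

set_option autoImplicit false
-- the mandated namespace repeats the single-problem summit's segment (`HodgeConjecture.HodgeConjecture`)
set_option linter.dupNamespace false

noncomputable section

open scoped Valued WithZero Matrix MatrixGroups

open _root_.NumberField _root_.IsDedekindDomain
open Literature.NumberTheory.Automorphic Literature.NumberTheory.Automorphic.HermitianLattice
  Literature.NumberTheory.Automorphic.UnitaryGroup

namespace Summit.HodgeConjecture.HodgeConjecture.R90.S6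

/-! ## (F.0)∕(F.0′) general quadratic extension `E ∕ F`, generic `N` -/

section General

variable {F E : Type} [Field F] [NumberField F] [Field E] [NumberField E] [Algebra F E] [Algebra.IsQuadraticExtension F E]
  (c : E ≃ₐ[F] E) (N : ℕ) (J : Matrix (Fin N) (Fin N) E) {v : HeightOneSpectrum (𝓞 F)}

/-- **W9-A′ (F.0) THE FRAME, general currency.**  `c ≠ 1`, `J` `c`-hermitian, `w ∣ v` non-split (`c • w = w`), `v` unramified in `E`, `J_w ∈ GL_N(𝒪_w)`:
there are `T ∈ GL_N(𝒪_w)` (Jacobowitz's integral hyperbolic basis, ★ `exists_glInt_placeForm_eq_formCongr_antidiagonal_of_isUnramifiedIn`) and an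
isomorphism of topological groups `e₀ : U(J)(F_v) ≃ₜ* U(σ_w, J₀)(E_w)` (`J₀ = (StdForm.antidiagonal N).over E_w`) with the MATRIX LAW
`(e₀ g)_w = T · g_w · T⁻¹` (`g_w = localNonsplitEquiv g`; ★ `localNonsplitCongr … T` then ★ `localNonsplitEquiv` for `Φ_N`, seam (S1) ★ `placeForm_antidiagOne`
via ★ `ContinuousMulEquiv.restrictSubgroup (refl _)`, ★ `localNonsplitEquiv_localNonsplitCongr`) and the LEVEL LAW `e₀ g ∈ unitaryInt σ_w J₀ ↔ g ∈ U(J)(𝒪_v)`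
(★ `mem_localIntegralLevel_iff_of_smul_eq` + seam (S2) ★ `mem_unitaryInt_iff` ∕ ★ `mem_glInt_iff_forall_v_le_one` + conjugation by `T ∈ GL_N(𝒪_w)`).
[cite: Rogawski1990, §14.2 p. 233] [cite: Jacobowitz1962, §7 Thm. 7.1] [cite: PlatonovRapinchuk1994, §5.1] -/
theorem exists_continuousMulEquiv_memLaw_unitaryInt_of_isUnramifiedIn (hc : c ≠ 1) (hJh : (J.map c)ᵀ = J)
    (w : PlacesOver E v) (hw : c • w.1 = w.1) (hv : Algebra.IsUnramifiedIn (𝓞 E) v.asIdeal)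
    (hJw : IsUnit (placeForm J w.1)) (hJi : hJw.unit ∈ glInt N (w.1.adicCompletion E)) :
    ∃ (T : GL (Fin N) (w.1.adicCompletion E))
      (e₀ : ↥(UnitaryGroup.«local» E c N J v) ≃ₜ*
        ↥(unitaryGroupOfForm (galAdicCompletionMap (L := E) c hw) ((StdForm.antidiagonal N).over (w.1.adicCompletion E)))),
      T ∈ glInt N (w.1.adicCompletion E) ∧
      (∀ g, ((e₀ g).val : GL (Fin N) (w.1.adicCompletion E)) =
        T * ((localNonsplitEquiv c J hc w hw g).val : GL (Fin N) (w.1.adicCompletion E)) * T⁻¹) ∧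
      ∀ g, e₀ g ∈ unitaryInt (galAdicCompletionMap (L := E) c hw) ((StdForm.antidiagonal N).over (w.1.adicCompletion E)) ↔
        g ∈ UnitaryGroup.localIntegralLevel c N J v := by
  obtain ⟨T, hT, hJT⟩ :=
    exists_glInt_placeForm_eq_formCongr_antidiagonal_of_isUnramifiedIn F E c hc N J hJh v w hw hv hJw hJi
  have h : formCongr (galAdicCompletionMap (L := E) c hw) T
      (placeForm (Matrix.of fun i j : Fin N => if i.val + j.val + 1 = N then (1 : E) else 0) w.1) =
        (1 : w.1.adicCompletion E) • placeForm J w.1 := by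
    rw [one_smul, placeForm_antidiagOne, ← hJT]
  -- seam (S1): `U(σ_w, placeForm Φ_N w) ≃ₜ* U(σ_w, (StdForm.antidiagonal N).over E_w)`, identity on matrices
  have hmem : ∀ a : GL (Fin N) (w.1.adicCompletion E),
      a ∈ unitaryGroupOfForm (galAdicCompletionMap (L := E) c hw)
          (placeForm (Matrix.of fun i j : Fin N => if i.val + j.val + 1 = N then (1 : E) else 0) w.1) ↔
        (ContinuousMulEquiv.refl (GL (Fin N) (w.1.adicCompletion E))) a ∈
          unitaryGroupOfForm (galAdicCompletionMap (L := E) c hw) ((StdForm.antidiagonal N).over (w.1.adicCompletion E)) := by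
    intro a
    rw [ContinuousMulEquiv.refl_apply, placeForm_antidiagOne]
  refine ⟨T, ((localNonsplitCongr c hc w hw T isUnit_one h).trans
      (localNonsplitEquiv c (Matrix.of fun i j : Fin N => if i.val + j.val + 1 = N then (1 : E) else 0) hc w hw)).trans
      (ContinuousMulEquiv.restrictSubgroup (ContinuousMulEquiv.refl (GL (Fin N) (w.1.adicCompletion E))) _ _ hmem), hT, ?_⟩
  have hform : ∀ g, (((((localNonsplitCongr c hc w hw T isUnit_one h).trans
      (localNonsplitEquiv c (Matrix.of fun i j : Fin N => if i.val + j.val + 1 = N then (1 : E) else 0) hc w hw)).trans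
      (ContinuousMulEquiv.restrictSubgroup (ContinuousMulEquiv.refl (GL (Fin N) (w.1.adicCompletion E))) _ _ hmem)) g).val :
        GL (Fin N) (w.1.adicCompletion E)) =
      T * ((localNonsplitEquiv c J hc w hw g).val : GL (Fin N) (w.1.adicCompletion E)) * T⁻¹ := by
    intro g
    rw [ContinuousMulEquiv.trans_apply, ContinuousMulEquiv.trans_apply, ContinuousMulEquiv.coe_restrictSubgroup_apply,
      ContinuousMulEquiv.refl_apply]
    exact localNonsplitEquiv_localNonsplitCongr c hc w hw T isUnit_one h g
  refine ⟨hform, fun g => ?_⟩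
  rw [mem_unitaryInt_iff, ← Literature.NumberTheory.Automorphic.mem_glInt_iff_forall_v_le_one, hform g,
    mem_localIntegralLevel_iff_of_smul_eq c N J hc w hw g]
  constructor
  · intro h'
    have h'' := Subgroup.mul_mem _ (Subgroup.mul_mem _ (Subgroup.inv_mem _ hT) h') hT
    simpa only [mul_assoc, mul_inv_cancel_left, inv_mul_cancel, mul_one, inv_mul_cancel_left] using h''
  · intro h'
    exact Subgroup.mul_mem _ (Subgroup.mul_mem _ hT h') (Subgroup.inv_mem _ hT)

/-- **W9-A′ (F.0′) THE FRAME for the quasi-split form `Φ_N` itself, general currency, `T = 1`, no `hv`.**  At a non-split place `w ∣ v`, the one-place model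
★ `localNonsplitEquiv` read on `J₀ = (StdForm.antidiagonal N).over E_w` (seam (S1) ★ `placeForm_antidiagOne` via ★ `ContinuousMulEquiv.restrictSubgroup (refl _)`)
is a frame `e₀ : U(Φ_N)(F_v) ≃ₜ* U(σ_w, J₀)(E_w)` with `(e₀ g)_w = g_w` and `e₀ g ∈ unitaryInt σ_w J₀ ↔ g ∈ U(Φ_N)(𝒪_v)` (★ `mem_localIntegralLevel_iff_of_smul_eq` +
seam (S2)). [cite: PlatonovRapinchuk1994, §5.1] -/
theorem exists_continuousMulEquiv_memLaw_unitaryInt_antidiagOne_of_smul_eq (hc : c ≠ 1) (w : PlacesOver E v) (hw : c • w.1 = w.1) :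
    ∃ e₀ : ↥(UnitaryGroup.«local» E c N (Matrix.of fun i j : Fin N => if i.val + j.val + 1 = N then (1 : E) else 0) v) ≃ₜ*
        ↥(unitaryGroupOfForm (galAdicCompletionMap (L := E) c hw) ((StdForm.antidiagonal N).over (w.1.adicCompletion E))),
      (∀ g, ((e₀ g).val : GL (Fin N) (w.1.adicCompletion E)) =
        ((localNonsplitEquiv c (Matrix.of fun i j : Fin N => if i.val + j.val + 1 = N then (1 : E) else 0) hc w hw g).val :
          GL (Fin N) (w.1.adicCompletion E))) ∧
      ∀ g, e₀ g ∈ unitaryInt (galAdicCompletionMap (L := E) c hw) ((StdForm.antidiagonal N).over (w.1.adicCompletion E)) ↔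
        g ∈ UnitaryGroup.localIntegralLevel c N (Matrix.of fun i j : Fin N => if i.val + j.val + 1 = N then (1 : E) else 0) v := by
  have hmem : ∀ a : GL (Fin N) (w.1.adicCompletion E),
      a ∈ unitaryGroupOfForm (galAdicCompletionMap (L := E) c hw)
          (placeForm (Matrix.of fun i j : Fin N => if i.val + j.val + 1 = N then (1 : E) else 0) w.1) ↔
        (ContinuousMulEquiv.refl (GL (Fin N) (w.1.adicCompletion E))) a ∈
          unitaryGroupOfForm (galAdicCompletionMap (L := E) c hw) ((StdForm.antidiagonal N).over (w.1.adicCompletion E)) := by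
    intro a
    rw [ContinuousMulEquiv.refl_apply, placeForm_antidiagOne]
  refine ⟨(localNonsplitEquiv c (Matrix.of fun i j : Fin N => if i.val + j.val + 1 = N then (1 : E) else 0) hc w hw).trans
      (ContinuousMulEquiv.restrictSubgroup (ContinuousMulEquiv.refl (GL (Fin N) (w.1.adicCompletion E))) _ _ hmem),
    fun g => ?_, fun g => ?_⟩
  · rw [ContinuousMulEquiv.trans_apply, ContinuousMulEquiv.coe_restrictSubgroup_apply, ContinuousMulEquiv.refl_apply]
  · rw [mem_unitaryInt_iff, ← Literature.NumberTheory.Automorphic.mem_glInt_iff_forall_v_le_one, ContinuousMulEquiv.trans_apply,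
      ContinuousMulEquiv.coe_restrictSubgroup_apply, ContinuousMulEquiv.refl_apply]
    exact (mem_localIntegralLevel_iff_of_smul_eq c N _ hc w hw g).symm

end General

/-! ## (F.1)∕(F.2) CM field `L` (`F = L⁺`, `c` = complex conjugation): the carriers `(cmDatum L N H).Local v` of the S6 sockets -/

section CM

variable (L : Type) [Field L] [NumberField L] [IsCMField L]

/-- **W9-A′ (F.1) THE FRAME `e₀` of the E1.3.9 ∕ E1.4.4.5a sockets (CM, `N = 3`; binders of ★ `exists_frame_of_nonsplit` verbatim).**  For a CM field `L`, a
hermitian `H′ ∈ M₃(L)`, an inert place `w ∣ v` (`c • w = w`, `v` unramified in `L`) with `H′_w ∈ GL₃(𝒪_w)`: there are `T ∈ GL₃(𝒪_w)` and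
`e₀ : (cmDatum L 3 H′).Local v ≃ₜ* U(σ_w, J₀)(L_w)` with `(e₀ g)_w = T g_w T⁻¹` and `∀ g, e₀ g ∈ unitaryInt σ_w J₀ ↔ g ∈ cmLocalIntegralLevel L 3 H′ v` — the last
conjunct is the K-law binder of `StubR90ExtE1HeckeFL` ∕ `StubR90ExtE1TwistedTransferFL` conj. 2 token for token, so their `∀ eG, (K-law) → …` is inhabited
(«`K_v ≃ K′_v`» of Rogawski §14.2).  Proof: (F.0) at `F := L⁺`, `c := IsCMField.complexConj L` — ★ `cmDatum_Local` is `rfl` and `cmLocalIntegralLevel` an `abbrev`,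
so the `∃`-statements unify. [cite: Rogawski1990, §14.2 p. 233; §4.9 p. 54] [cite: Jacobowitz1962, §7 Thm. 7.1] [cite: PlatonovRapinchuk1994, §5.1] -/
theorem exists_continuousMulEquiv_memLaw_unitaryInt_cm_three (H' : Matrix (Fin 3) (Fin 3) L)
    {v : HeightOneSpectrum (𝓞 ↥(maximalRealSubfield L))} (hH' : (H'.map (IsCMField.complexConj L))ᵀ = H')
    (w : PlacesOver L v) (hw : IsCMField.complexConj L • w.1 = w.1) (hv : Algebra.IsUnramifiedIn (𝓞 L) v.asIdeal)
    (hH'w : IsUnit (placeForm H' w.1)) (hH'i : hH'w.unit ∈ glInt 3 (w.1.adicCompletion L)) :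
    ∃ (T : GL (Fin 3) (w.1.adicCompletion L))
      (e₀ : (UnitaryGroup.cmDatum L 3 H').Local v ≃ₜ*
        ↥(unitaryGroupOfForm (galAdicCompletionMap (L := L) (IsCMField.complexConj L) hw) ((StdForm.antidiagonal 3).over (w.1.adicCompletion L)))),
      T ∈ glInt 3 (w.1.adicCompletion L) ∧
      (∀ g, ((e₀ g).val : GL (Fin 3) (w.1.adicCompletion L)) =
        T * ((localNonsplitEquiv (IsCMField.complexConj L) H' (IsCMField.complexConj_ne_one L) w hw g).val :
          GL (Fin 3) (w.1.adicCompletion L)) * T⁻¹) ∧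
      ∀ g : (UnitaryGroup.cmDatum L 3 H').Local v,
        e₀ g ∈ unitaryInt (galAdicCompletionMap (L := L) (IsCMField.complexConj L) hw) ((StdForm.antidiagonal 3).over (w.1.adicCompletion L)) ↔
          g ∈ UnitaryGroup.cmLocalIntegralLevel L 3 H' v :=
  exists_continuousMulEquiv_memLaw_unitaryInt_of_isUnramifiedIn (IsCMField.complexConj L) 3 H' (IsCMField.complexConj_ne_one L) hH' w hw hv hH'w hH'i

/-- **W9-A′ (F.2) THE FRAME for the quasi-split carrier `U(Φ_N)` (CM, `Φ_N`-literal, generic `N`; the `eH` carrier at `N = 2`, D :304–:306).**  For a CM field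
`L`, any `N`, an inert place `w ∣ v`: the one-place model ★ `localNonsplitEquiv` read on `J₀ = (StdForm.antidiagonal N).over L_w` is a frame
`e₀ : (cmDatum L N Φ_N).Local v ≃ₜ* U(σ_w, J₀)(L_w)` with `(e₀ g)_w = g_w` and `∀ g, e₀ g ∈ unitaryInt σ_w J₀ ↔ g ∈ cmLocalIntegralLevel L N Φ_N v`.
Proof: (F.0′) at `F := L⁺`, `c := IsCMField.complexConj L` (`exact`; ★ `cmDatum_Local` `rfl`). [cite: PlatonovRapinchuk1994, §5.1] [cite: Rogawski1990, §4.9 p. 54] -/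
theorem exists_continuousMulEquiv_memLaw_unitaryInt_cm_antidiagOne (N : ℕ) {v : HeightOneSpectrum (𝓞 ↥(maximalRealSubfield L))}
    (w : PlacesOver L v) (hw : IsCMField.complexConj L • w.1 = w.1) :
    ∃ e₀ : (UnitaryGroup.cmDatum L N (Matrix.of fun i j : Fin N => if i.val + j.val + 1 = N then (1 : L) else 0)).Local v ≃ₜ*
        ↥(unitaryGroupOfForm (galAdicCompletionMap (L := L) (IsCMField.complexConj L) hw) ((StdForm.antidiagonal N).over (w.1.adicCompletion L))),
      (∀ g, ((e₀ g).val : GL (Fin N) (w.1.adicCompletion L)) =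
        ((localNonsplitEquiv (IsCMField.complexConj L) (Matrix.of fun i j : Fin N => if i.val + j.val + 1 = N then (1 : L) else 0)
            (IsCMField.complexConj_ne_one L) w hw g).val : GL (Fin N) (w.1.adicCompletion L))) ∧
      ∀ g : (UnitaryGroup.cmDatum L N (Matrix.of fun i j : Fin N => if i.val + j.val + 1 = N then (1 : L) else 0)).Local v,
        e₀ g ∈ unitaryInt (galAdicCompletionMap (L := L) (IsCMField.complexConj L) hw) ((StdForm.antidiagonal N).over (w.1.adicCompletion L)) ↔
          g ∈ UnitaryGroup.cmLocalIntegralLevel L N (Matrix.of fun i j : Fin N => if i.val + j.val + 1 = N then (1 : L) else 0) v :=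
  exists_continuousMulEquiv_memLaw_unitaryInt_antidiagOne_of_smul_eq (IsCMField.complexConj L) N (IsCMField.complexConj_ne_one L) w hw

end CM

end Summit.HodgeConjecture.HodgeConjecture.R90.S6

end
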